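import Literature.NumberTheory.Automorphic.UnitaryDualPairDoubledLineStabiliser
import Literature.NumberTheory.Weil1964.AdelicDoublingDeltaVectors
import Literature.NumberTheory.Weil1964.AdelicSiegelBigCellCriterion
import HarnessLib

/-!
# The main orbit of the doubled unitary line: `ι(1 ⊗ γ)` is an `E`-scalar, and the cosets `γ ≠ 1` lie in the big cell

Topic `NumberTheory/Automorphic`; namespace `Literature.NumberTheory.Automorphic.UnitaryGroup`.  KERNEL MATHEMATICS ONLY:
theorems with proofs; no `def … : Prop`, no `axiom`, no proof hole.  Sequel of `UnitaryDualPairDoubledLineStabiliser`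
(rational stabiliser of `V ⊗ W^Δ`; `ι_{eD}(1 ⊗ (γ ⊕ 1)) = ι_e(1 ⊗ γ) ⊕ 1`) and of `Weil1964/AdelicDoublingDeltaVectors`
(the main-orbit Lagrangian `δ((g ⊕ 1) W^Δ)` of an `E`-scalar `g` is the graph of `−𝕋₂⁻¹σ`), feeding the big-cell criterion
`Weil1964/AdelicSiegelBigCellCriterion` — for the unfolding of the Siegel Eisenstein series of `Sp(𝕎□)` over the rational
points of the rank-one unitary group `U(W) = E¹` ([GelbartPiatetskishapiroRallis1987, Part A §2: the main orbit of
`G × G` on `P \ H`]; [Kudla1994, §1]; [HarrisKudlaSweet1996, §1 (1.2)]).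

§1 `toSp_adelicInr_toAdelic_apply`: for `γ ∈ U(T_W)(F) ≤ GL₁(E)` (so `γ = p + q√d`, `p = re γ₀₀`, `q = im γ₀₀`), the
pair embedding `ι_e(1_V ⊗ γ)` acts on `𝕎_𝔸 = 𝔸^n × 𝔸^n` (real ∕ imaginary polarisation) as the `E`-SCALAR
`(x, y) ↦ (p x + d q y, q x + p y)` [GelbartRogawski1991, §3.1 p. 455].
§2 `re_sq_sub_mul_im_sq_eq_one`: unitarity of a `1 × 1` matrix is `γ γ̄ = 1`, i.e. `p² − d q² = 1`; `re_ne_one_of_ne_one`: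
`γ ≠ 1 ⇒ p ≠ 1`; the Cayley parameter `β = q / (2(1 − p))` satisfies `2β(1 − p) = q` and `2dqβ + p + 1 = 0`.
§3 `bigCell_conditions_spReindex`: the two clauses of the Siegel-parabolic big-cell criterion are invariant under a renumbering
`spReindex e` (slope `reindex e e M₀`).
§4 In the E-2 child's carriers (`T = adelicGram e T_V T_W`, `𝕋 = doubledGramFin F T`, Li's `δ = doublingDeltaRat F`): for any
rational symplectic `x` over `ι_{eD}(1 ⊗ (γ ⊕ 1)) = ι_e(1 ⊗ γ) ⊕ 1` (hypothesis `hx`, supplied by the SW3 orbit package) the element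
`δ x⁻¹ δ⁻¹` satisfies the two clauses (`bigCell_conditions_of_ratSp_eq`, slope `𝕋⁻¹ σ_γ`,
`σ_γ = reindex [[β 𝕋_F, −h], [−h, −dβ 𝕋_F⁻¹]]` rational symmetric: `isSymm_sigma0`, `doubledGramFin_inv_mul_ratMatrix_sigma0`), hence
lies in the big cell (`ratSp_conj_inv_mem_bigCell_of_ratSp_eq`), hence — by `Weil1964/AdelicSiegelBigCellCriterion` — the `γ`-th
term of the Siegel Eisenstein series `E(Ψ) = Σ_{P_W(F)\U(W□)(F)} (ω□(r_F δ) ω□(r_F x⁻¹) Ψ)(0)` is the orbital integral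
`∫ ψ_F(−½ ᵗv σ_γ v) (ω□(r_F δ)Ψ)(v) dν(v)` (`omega_doublingDeltaLift_omega_ratThetaLiftCont_inv_apply_zero_of_ratSp_eq`, and
`…_of_ne_one` with `β = q/(2(1 − p))`, `h = ½` discharged for every `γ ≠ 1`).  [Weil1965, n° 39 (30) p. 55; n° 46 p. 66].
-/

set_option autoImplicit false

noncomputable section

open scoped Kronecker Matrix
open NumberField
open Literature.RepresentationTheory.HeisenbergGroup Literature.RepresentationTheory.HeisenbergGroup.SymplecticMatrix
open Literature.NumberTheory.Weil1964
open MeasureTheory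
open Literature.NumberTheory.GelbartRogawski1991 Literature.NumberTheory.GelbartRogawski1991.UnitaryDualPair

namespace Literature.NumberTheory.Automorphic

namespace UnitaryGroup

/-! ## §1 `ι_e(1 ⊗ γ)` is the `E`-scalar `γ` on `𝕎_𝔸` -/

section Scalar

variable (F E : Type) [Field F] [NumberField F] [Field E] [NumberField E] [Algebra F E] [Algebra.IsQuadraticExtension F E]
  (c : E ≃ₐ[F] E) {δ : E} (hcδ : c δ = -δ) (hδ : δ ≠ 0) {d : F} (hd : δ * δ = algebraMap F E d)
  (N : ℕ) {n : ℕ} (e : Fin N × Fin 1 ≃ Fin n)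
  {TV : Matrix (Fin N) (Fin N) F} {TW : Matrix (Fin 1) (Fin 1) F} (hV : TV.IsSymm) (hW : TW.IsSymm)

/-- `1_N ⊗ M` for a `1 × 1` matrix `M` acts as the scalar `M₀₀`. [cite: HarrisKudlaSweet1996, §1 (1.11)] -/
theorem one_kronecker_fin_one_mulVec {A : Type*} [CommRing A] (M : Matrix (Fin 1) (Fin 1) A) (a : Fin N × Fin 1 → A) :
    ((1 : Matrix (Fin N) (Fin N) A) ⊗ₖ M) *ᵥ a = M 0 0 • a := by
  funext p
  rw [one_kronecker_mulVec, Fin.sum_univ_one, Pi.smul_apply, smul_eq_mul, Fin.fin_one_eq_zero p.2]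
  congr 2
  exact Prod.ext rfl (Fin.fin_one_eq_zero p.2).symm

/-- **`ι_e(1_V ⊗ γ)` IS THE `E`-SCALAR `γ`**: for `γ ∈ U(T_W)(F) ≤ GL₁(E)` with `γ₀₀ = p + q δ` (`p = re γ₀₀`, `q = im γ₀₀`
in the coordinates `E = F ⊕ F δ`, `δ² = d`), the pair embedding acts on `𝕎_𝔸 = 𝔸_F^n × 𝔸_F^n` by
`(x, y) ↦ (p x + d q y, q x + p y)`. [cite: GelbartRogawski1991, §3.1 p. 455] -/
theorem toSp_adelicInr_toAdelic_apply (γ : rational F E c 1 (TW.map (algebraMap F E)))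
    (x y : Fin n → AdeleRing (𝓞 F) F) :
    ((UnitaryDualPair.toSp F E c N 1 e (TV.map (algebraMap F E)) (TW.map (algebraMap F E)) hcδ hδ hd hV hW rfl rfl
          (adelicInr F E c N 1 (TV.map (algebraMap F E)) (TW.map (algebraMap F E))
            (toAdelic F E c 1 (TW.map (algebraMap F E)) γ)) :
          symplecticGroup (polar (Weil1964.adelicForm F (Fin n) (UnitaryDualPair.adelicGram F e TV TW)))) :
        ((Fin n → AdeleRing (𝓞 F) F) × (Fin n → AdeleRing (𝓞 F) F)) ≃ₗ[AdeleRing (𝓞 F) F]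
          ((Fin n → AdeleRing (𝓞 F) F) × (Fin n → AdeleRing (𝓞 F) F))) (x, y) =
      (algebraMap F (AdeleRing (𝓞 F) F)
            (QuadraticCoordinates.re (quadraticRatCoords E (not_mem_range_algebraMap_of_apply_eq_neg E c hcδ hδ)).toAddEquiv
              (((γ : GL (Fin 1) E) : Matrix (Fin 1) (Fin 1) E) 0 0)) • x +
          algebraMap F (AdeleRing (𝓞 F) F) (d *
            QuadraticCoordinates.im (quadraticRatCoords E (not_mem_range_algebraMap_of_apply_eq_neg E c hcδ hδ)).toAddEquiv
              (((γ : GL (Fin 1) E) : Matrix (Fin 1) (Fin 1) E) 0 0)) • y,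
        algebraMap F (AdeleRing (𝓞 F) F)
            (QuadraticCoordinates.im (quadraticRatCoords E (not_mem_range_algebraMap_of_apply_eq_neg E c hcδ hδ)).toAddEquiv
              (((γ : GL (Fin 1) E) : Matrix (Fin 1) (Fin 1) E) 0 0)) • x +
          algebraMap F (AdeleRing (𝓞 F) F)
            (QuadraticCoordinates.re (quadraticRatCoords E (not_mem_range_algebraMap_of_apply_eq_neg E c hcδ hδ)).toAddEquiv
              (((γ : GL (Fin 1) E) : Matrix (Fin 1) (Fin 1) E) 0 0)) • y) := by
  have hcoe : (((rationalInr F E c N 1 (TV.map (algebraMap F E)) (TW.map (algebraMap F E)) γ :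
      rationalPair F E c N 1 (TV.map (algebraMap F E)) (TW.map (algebraMap F E))) : GL (Fin N × Fin 1) E) :
      Matrix (Fin N × Fin 1) (Fin N × Fin 1) E) = (1 : Matrix (Fin N) (Fin N) E) ⊗ₖ ((γ : GL (Fin 1) E) : Matrix (Fin 1) (Fin 1) E) :=
    rfl
  rw [adelicInr_toAdelic, UnitaryDualPair.toSp_apply, coe_spReindex_apply, reindexW_symm_apply]
  dsimp only
  rw [adelicPairToSymplectic_rationalPairToAdelic_apply, hcoe, one_kronecker_map, one_kronecker_map, one_kronecker_map,
    one_kronecker_map, one_kronecker_fin_one_mulVec, one_kronecker_fin_one_mulVec, one_kronecker_fin_one_mulVec,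
    one_kronecker_fin_one_mulVec, reindexW_apply]
  simp only [Matrix.map_apply, smul_smul, map_mul]
  refine Prod.ext (funext fun i => ?_) (funext fun i => ?_) <;>
    simp only [Function.comp_apply, Pi.add_apply, Pi.smul_apply, Equiv.apply_symm_apply]

end Scalar

/-! ## §2 Unitarity of a `1 × 1` matrix: `γ γ̄ = 1`, i.e. `p² − d q² = 1`; the Cayley parameter -/

section NormOne

variable {F E : Type} [Field F] [Field E] [Algebra F E] (c : E ≃ₐ[F] E) {δ : E} (hcδ : c δ = -δ) (hδ : δ ≠ 0) {d : F}
  {Ψ : (F × F) ≃+ E} (h : IsQuadraticCoordinates (algebraMap F E) Ψ δ d)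
  {TW : Matrix (Fin 1) (Fin 1) F} (hWd : IsUnit TW.det)

include h hcδ in
/-- the conjugation in coordinates: `re (c x) = re x`. [cite: GelbartRogawski1991, §3.1 p. 455] -/
theorem re_conj (x : E) : QuadraticCoordinates.re Ψ (c x) = QuadraticCoordinates.re Ψ x := by
  conv_lhs => rw [← h.re_add_im x]
  rw [map_add, map_mul, AlgEquiv.commutes, AlgEquiv.commutes, hcδ, mul_neg, ← neg_mul, ← map_neg, h.re_eq]

include h hcδ in
/-- the conjugation in coordinates: `im (c x) = −im x`. [cite: GelbartRogawski1991, §3.1 p. 455] -/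
theorem im_conj (x : E) : QuadraticCoordinates.im Ψ (c x) = -QuadraticCoordinates.im Ψ x := by
  conv_lhs => rw [← h.re_add_im x]
  rw [map_add, map_mul, AlgEquiv.commutes, AlgEquiv.commutes, hcδ, mul_neg, ← neg_mul, ← map_neg, h.im_eq]

include hWd in
/-- a `1 × 1` unitary matrix is a norm-one scalar: `c(γ₀₀) · γ₀₀ = 1`. [cite: Mok2014, §1 Notation p. 5] -/
theorem conj_mul_self_eq_one (γ : rational F E c 1 (TW.map (algebraMap F E))) :
    c (((γ : GL (Fin 1) E) : Matrix (Fin 1) (Fin 1) E) 0 0) * ((γ : GL (Fin 1) E) : Matrix (Fin 1) (Fin 1) E) 0 0 = 1 := by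
  have hmem := mem_unitaryGroupOfForm_iff.1 γ.2
  have h00 := congrFun (congrFun hmem 0) 0
  simp only [Matrix.mul_apply, Fin.sum_univ_one, Matrix.transpose_apply, Matrix.map_apply, RingHom.coe_coe] at h00
  have ht : algebraMap F E (TW 0 0) ≠ 0 := by
    rw [map_ne_zero_iff _ (algebraMap F E).injective, ← Matrix.det_fin_one TW]
    exact hWd.ne_zero
  have h' : (c (((γ : GL (Fin 1) E) : Matrix (Fin 1) (Fin 1) E) 0 0) * ((γ : GL (Fin 1) E) : Matrix (Fin 1) (Fin 1) E) 0 0) *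
      algebraMap F E (TW 0 0) = 1 * algebraMap F E (TW 0 0) := by
    rw [one_mul]
    linear_combination h00
  exact mul_right_cancel₀ ht h'

include h hcδ hWd in
/-- **`p² − d q² = 1`** for `γ₀₀ = p + q δ`, `γ ∈ U(T_W)(F) ≤ GL₁(E)`. [cite: Mok2014, §1 Notation p. 5] -/
theorem re_sq_sub_mul_im_sq (γ : rational F E c 1 (TW.map (algebraMap F E))) :
    QuadraticCoordinates.re Ψ (((γ : GL (Fin 1) E) : Matrix (Fin 1) (Fin 1) E) 0 0) *
          QuadraticCoordinates.re Ψ (((γ : GL (Fin 1) E) : Matrix (Fin 1) (Fin 1) E) 0 0) -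
        d * (QuadraticCoordinates.im Ψ (((γ : GL (Fin 1) E) : Matrix (Fin 1) (Fin 1) E) 0 0) *
          QuadraticCoordinates.im Ψ (((γ : GL (Fin 1) E) : Matrix (Fin 1) (Fin 1) E) 0 0)) = 1 := by
  have h1 := congrArg (QuadraticCoordinates.re Ψ) (conj_mul_self_eq_one c hWd γ)
  rw [h.re_mul, re_conj c hcδ h, im_conj c hcδ h, h.re_one] at h1
  linear_combination h1

include h hcδ hδ hWd in
/-- **`γ ≠ 1 ⇒ re γ₀₀ ≠ 1`** (if `p = 1` then `d q² = 0`, `d ≠ 0`, so `q = 0` and `γ = 1`). [cite: Mok2014, §1 Notation p. 5] -/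
theorem re_ne_one_of_ne_one (γ : rational F E c 1 (TW.map (algebraMap F E))) (hγ : γ ≠ 1) :
    QuadraticCoordinates.re Ψ (((γ : GL (Fin 1) E) : Matrix (Fin 1) (Fin 1) E) 0 0) ≠ 1 := by
  intro hp
  have hd0 : d ≠ 0 := by
    intro hd0
    apply hδ
    have := h.mul_self
    rw [hd0, map_zero] at this
    exact mul_self_eq_zero.1 this
  have hn := re_sq_sub_mul_im_sq c hcδ h hWd γ
  rw [hp, one_mul, sub_eq_self, mul_eq_zero, or_iff_right hd0, mul_self_eq_zero] at hn
  apply hγ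
  have h00 : ((γ : GL (Fin 1) E) : Matrix (Fin 1) (Fin 1) E) 0 0 = 1 := by
    rw [← h.re_add_im (((γ : GL (Fin 1) E) : Matrix (Fin 1) (Fin 1) E) 0 0), hp, hn, map_one, map_zero, zero_mul, add_zero]
  refine Subtype.ext (Units.ext (Matrix.ext fun i j => ?_))
  rw [Fin.fin_one_eq_zero i, Fin.fin_one_eq_zero j, h00]
  rfl

include h hcδ hδ hWd in
/-- **THE CAYLEY RELATIONS**: for `γ ≠ 1`, `β = q / (2(1 − p))` satisfies `2β(1 − p) = q`. [cite: GelbartPiatetskishapiroRallis1987, Part A §2 pp. 7–9] -/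
theorem two_mul_cayley_mul_one_sub_re [CharZero F] (γ : rational F E c 1 (TW.map (algebraMap F E))) (hγ : γ ≠ 1) :
    2 * (QuadraticCoordinates.im Ψ (((γ : GL (Fin 1) E) : Matrix (Fin 1) (Fin 1) E) 0 0) /
          (2 * (1 - QuadraticCoordinates.re Ψ (((γ : GL (Fin 1) E) : Matrix (Fin 1) (Fin 1) E) 0 0)))) *
        (1 - QuadraticCoordinates.re Ψ (((γ : GL (Fin 1) E) : Matrix (Fin 1) (Fin 1) E) 0 0)) =
      QuadraticCoordinates.im Ψ (((γ : GL (Fin 1) E) : Matrix (Fin 1) (Fin 1) E) 0 0) := by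
  have hp : (1 : F) - QuadraticCoordinates.re Ψ (((γ : GL (Fin 1) E) : Matrix (Fin 1) (Fin 1) E) 0 0) ≠ 0 :=
    sub_ne_zero.2 (Ne.symm (re_ne_one_of_ne_one c hcδ hδ h hWd γ hγ))
  field_simp

include h hcδ hδ hWd in
/-- **… and `2dqβ + p + 1 = 0`** (from `p² − dq² = 1`). [cite: GelbartPiatetskishapiroRallis1987, Part A §2 pp. 7–9] -/
theorem two_mul_mul_im_mul_cayley_add [CharZero F] (γ : rational F E c 1 (TW.map (algebraMap F E))) (hγ : γ ≠ 1) :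
    2 * d * QuadraticCoordinates.im Ψ (((γ : GL (Fin 1) E) : Matrix (Fin 1) (Fin 1) E) 0 0) *
          (QuadraticCoordinates.im Ψ (((γ : GL (Fin 1) E) : Matrix (Fin 1) (Fin 1) E) 0 0) /
            (2 * (1 - QuadraticCoordinates.re Ψ (((γ : GL (Fin 1) E) : Matrix (Fin 1) (Fin 1) E) 0 0)))) +
        QuadraticCoordinates.re Ψ (((γ : GL (Fin 1) E) : Matrix (Fin 1) (Fin 1) E) 0 0) + 1 = 0 := by
  have hp : (1 : F) - QuadraticCoordinates.re Ψ (((γ : GL (Fin 1) E) : Matrix (Fin 1) (Fin 1) E) 0 0) ≠ 0 :=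
    sub_ne_zero.2 (Ne.symm (re_ne_one_of_ne_one c hcδ hδ h hWd γ hγ))
  have hn := re_sq_sub_mul_im_sq c hcδ h hWd γ
  field_simp
  linear_combination (-1 : F) * hn

end NormOne

/-! ## §3 Transport of the big-cell conditions along a renumbering `spReindex` -/

section Reindex

variable {K : Type*} [CommRing K] {ι ι' : Type*} [Fintype ι] [Fintype ι'] [DecidableEq ι] [DecidableEq ι']

omit [DecidableEq ι] [DecidableEq ι'] in
/-- `((reindex e e M) a) ∘ e = M (a ∘ e)`. [folklore] -/
private theorem reindex_mulVec_comp (eι : ι ≃ ι') (M : Matrix ι ι K) (a : ι' → K) :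
    (Matrix.reindex eι eι M *ᵥ a) ∘ eι = M *ᵥ (a ∘ eι) := by
  rw [Matrix.reindex_apply, Matrix.submatrix_mulVec_equiv]
  funext i
  simp only [Function.comp_apply, Equiv.symm_apply_apply, Equiv.symm_symm]

omit [DecidableEq ι] [DecidableEq ι'] in
/-- `(M v) ∘ e⁻¹ = (reindex e e M) (v ∘ e⁻¹)`. [folklore] -/
private theorem mulVec_comp_symm (eι : ι ≃ ι') (M : Matrix ι ι K) (v : ι → K) :
    (M *ᵥ v) ∘ eι.symm = Matrix.reindex eι eι M *ᵥ (v ∘ eι.symm) := by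
  rw [Matrix.reindex_apply, Matrix.submatrix_mulVec_equiv]
  congr 2
  funext i
  simp only [Function.comp_apply, Equiv.symm_symm, Equiv.symm_apply_apply]

/-- **THE TWO BIG-CELL CLAUSES ARE INVARIANT UNDER RENUMBERING**: if `G₀ ∈ Sp(K^ι × K^ι, T₂)` satisfies
(i) `G₀ (a, −M₀ a) ∈ 𝕐` for all `a` and (ii) `G₀⁻¹ 𝕐 ⊆ {(a, −M₀ a)}`, then `spReindex e T₂ G₀` satisfies the same two clauses
for the slope `reindex e e M₀`. [cite: GelbartPiatetskishapiroRallis1987, Part A §2 pp. 7–9] -/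
theorem bigCell_conditions_spReindex (eι : ι ≃ ι') (T₂ : Matrix ι ι K)
    (G₀ : symplecticGroup (polar (Matrix.toLinearMap₂' K T₂))) (M₀ : Matrix ι ι K)
    (h : (∀ a : ι → K, (((G₀ : symplecticGroup (polar (Matrix.toLinearMap₂' K T₂))) :
            ((ι → K) × (ι → K)) ≃ₗ[K] ((ι → K) × (ι → K))) (a, -(M₀ *ᵥ a))).1 = 0) ∧
      ∀ b : ι → K, (((G₀ : symplecticGroup (polar (Matrix.toLinearMap₂' K T₂))) :
            ((ι → K) × (ι → K)) ≃ₗ[K] ((ι → K) × (ι → K))).symm (0, b)).2 =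
          -(M₀ *ᵥ (((G₀ : symplecticGroup (polar (Matrix.toLinearMap₂' K T₂))) :
            ((ι → K) × (ι → K)) ≃ₗ[K] ((ι → K) × (ι → K))).symm (0, b)).1)) :
    (∀ a : ι' → K, (((spReindex eι T₂ G₀ : symplecticGroup (polar (Matrix.toLinearMap₂' K (Matrix.reindex eι eι T₂)))) :
            ((ι' → K) × (ι' → K)) ≃ₗ[K] ((ι' → K) × (ι' → K))) (a, -(Matrix.reindex eι eι M₀ *ᵥ a))).1 = 0) ∧
      ∀ b : ι' → K, (((spReindex eι T₂ G₀ : symplecticGroup (polar (Matrix.toLinearMap₂' K (Matrix.reindex eι eι T₂)))) :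
            ((ι' → K) × (ι' → K)) ≃ₗ[K] ((ι' → K) × (ι' → K))).symm (0, b)).2 =
          -(Matrix.reindex eι eι M₀ *ᵥ (((spReindex eι T₂ G₀ : symplecticGroup (polar (Matrix.toLinearMap₂' K (Matrix.reindex eι eι T₂)))) :
            ((ι' → K) × (ι' → K)) ≃ₗ[K] ((ι' → K) × (ι' → K))).symm (0, b)).1) := by
  have hGs : ∀ v : (ι' → K) × (ι' → K),
      ((spReindex eι T₂ G₀ : symplecticGroup (polar (Matrix.toLinearMap₂' K (Matrix.reindex eι eι T₂)))) :
            ((ι' → K) × (ι' → K)) ≃ₗ[K] ((ι' → K) × (ι' → K))).symm v =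
        reindexW K eι (((G₀ : symplecticGroup (polar (Matrix.toLinearMap₂' K T₂))) :
            ((ι → K) × (ι → K)) ≃ₗ[K] ((ι → K) × (ι → K))).symm ((reindexW K eι).symm v)) := fun v => rfl
  refine ⟨fun a => ?_, fun b => ?_⟩
  · rw [coe_spReindex_apply, reindexW_symm_apply, reindexW_apply]
    dsimp only
    have hneg : (-(Matrix.reindex eι eι M₀ *ᵥ a)) ∘ eι = -(M₀ *ᵥ (a ∘ eι)) := by
      rw [← reindex_mulVec_comp eι M₀ a]; rfl
    rw [hneg, h.1 (a ∘ eι)]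
    rfl
  · rw [hGs, reindexW_symm_apply, reindexW_apply]
    dsimp only
    have h0 : (0 : ι' → K) ∘ eι = (0 : ι → K) := rfl
    rw [h0, h.2 (b ∘ eι), ← mulVec_comp_symm]
    rfl

end Reindex

/-! ## §4 The cosets `γ ≠ 1` of `P_W \ U(W□)(F)` lie in the big cell: slope and term formula in the E-2 child's carriers -/

section BigCell

variable (F E : Type) [Field F] [NumberField F] [Field E] [NumberField E] [Algebra F E] [Algebra.IsQuadraticExtension F E]
  (c : E ≃ₐ[F] E) {δ : E} (hcδ : c δ = -δ) (hδ : δ ≠ 0) {d : F} (hd : δ * δ = algebraMap F E d)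
  (N : ℕ) {n : ℕ} (e : Fin N × Fin 1 ≃ Fin n)
  {TV : Matrix (Fin N) (Fin N) F} {TW : Matrix (Fin 1) (Fin 1) F} (hV : TV.IsSymm) (hW : TW.IsSymm)
  (hVd : IsUnit TV.det) (hWd : IsUnit TW.det)

/-- matrix inversion commutes with entrywise ring maps on unit-determinant matrices (private copy of a folklore helper). [folklore] -/
private theorem map_nonsing_inv' {k R S : Type*} [Fintype k] [DecidableEq k] [CommRing R] [CommRing S] (f : R →+* S)
    {M : Matrix k k R} (hM : IsUnit M.det) : (M⁻¹).map f = (M.map f)⁻¹ := by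
  symm
  apply Matrix.inv_eq_left_inv
  rw [← Matrix.map_mul, Matrix.nonsing_inv_mul _ hM, Matrix.map_one _ (map_zero f) (map_one f)]

/-- `f (a b⁻¹ a⁻¹) = f a · (f b)⁻¹ · (f a)⁻¹` read in the ambient group of a subgroup-valued homomorphism (private plumbing). [folklore] -/
private theorem coe_map_mul_inv_mul_inv {G L : Type*} [Group G] [Group L] (H : Subgroup L) (f : G →* H) (a b : G) :
    ((f (a * b⁻¹ * a⁻¹) : H) : L) = (f a : L) * ((f b : H) : L)⁻¹ * ((f a : H) : L)⁻¹ := by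
  rw [map_mul, map_mul, map_inv, map_inv, Subgroup.coe_mul, Subgroup.coe_mul, Subgroup.coe_inv, Subgroup.coe_inv]

omit [NumberField F] in
include hV hW in
/-- the Gram matrix `𝕋_F = reindex e e (T_V ⊗ T_W)` is symmetric. [cite: GelbartRogawski1991, §3.1 p. 454] -/
theorem isSymm_gram : (UnitaryDualPair.gram F e TV TW).IsSymm := by
  refine isSymm_reindex e ?_
  unfold Matrix.IsSymm
  rw [← Matrix.kroneckerMap_transpose, hV.eq, hW.eq]

omit [NumberField F] in
include hV hW in
/-- the rational slope matrix `σ_γ = reindex ([[β 𝕋_F, −h], [−h, −dβ 𝕋_F⁻¹]])` is symmetric. [cite: GelbartPiatetskishapiroRallis1987, Part A §2 pp. 7–9] -/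
theorem isSymm_sigma0 (β h : F) :
    (Matrix.reindex finSumFinEquiv finSumFinEquiv
          (Matrix.fromBlocks (β • (UnitaryDualPair.gram F e TV TW)) (-(h • (1 : Matrix (Fin n) (Fin n) F))) (-(h • (1 : Matrix (Fin n) (Fin n) F)))
            (-((d * β) • (UnitaryDualPair.gram F e TV TW)⁻¹)))).IsSymm :=
  isSymm_reindex _ (Weil1964.isSymm_sigma (UnitaryDualPair.gram F e TV TW) d β h (isSymm_gram F N e hV hW))

include hVd hWd in
/-- **THE SLOPE IN THE CHILD'S CARRIERS**: `𝕋⁻¹ · σ_γ ⊗ 1 = reindex ((T ⊕ −T)⁻¹ · [[β T, −h], [−h, −dβ T⁻¹]])` with `T = 𝕋_F ⊗ 1` the adelic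
Gram matrix. [cite: GelbartPiatetskishapiroRallis1987, Part A §2 pp. 7–9] -/
theorem doubledGramFin_inv_mul_ratMatrix_sigma0 (β h : F) :
    (doubledGramFin F (UnitaryDualPair.adelicGram F e TV TW))⁻¹ * ratMatrix F
        (Matrix.reindex finSumFinEquiv finSumFinEquiv
          (Matrix.fromBlocks (β • (UnitaryDualPair.gram F e TV TW)) (-(h • (1 : Matrix (Fin n) (Fin n) F))) (-(h • (1 : Matrix (Fin n) (Fin n) F)))
            (-((d * β) • (UnitaryDualPair.gram F e TV TW)⁻¹)))) =
      Matrix.reindex finSumFinEquiv finSumFinEquiv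
        ((Matrix.fromBlocks (UnitaryDualPair.adelicGram F e TV TW) 0 0 (-(UnitaryDualPair.adelicGram F e TV TW)))⁻¹ *
          (Matrix.fromBlocks ((algebraMap F (AdeleRing (𝓞 F) F)) β • (UnitaryDualPair.adelicGram F e TV TW)) (-((algebraMap F (AdeleRing (𝓞 F) F)) h • (1 : Matrix (Fin n) (Fin n) (AdeleRing (𝓞 F) F))))
            (-((algebraMap F (AdeleRing (𝓞 F) F)) h • (1 : Matrix (Fin n) (Fin n) (AdeleRing (𝓞 F) F)))) (-(((algebraMap F (AdeleRing (𝓞 F) F)) d * (algebraMap F (AdeleRing (𝓞 F) F)) β) • (UnitaryDualPair.adelicGram F e TV TW)⁻¹)))) := by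
  have hS : ratMatrix F
        (Matrix.reindex finSumFinEquiv finSumFinEquiv
          (Matrix.fromBlocks (β • (UnitaryDualPair.gram F e TV TW)) (-(h • (1 : Matrix (Fin n) (Fin n) F))) (-(h • (1 : Matrix (Fin n) (Fin n) F)))
            (-((d * β) • (UnitaryDualPair.gram F e TV TW)⁻¹)))) =
      Matrix.reindex finSumFinEquiv finSumFinEquiv
        (Matrix.fromBlocks ((algebraMap F (AdeleRing (𝓞 F) F)) β • (UnitaryDualPair.adelicGram F e TV TW)) (-((algebraMap F (AdeleRing (𝓞 F) F)) h • (1 : Matrix (Fin n) (Fin n) (AdeleRing (𝓞 F) F))))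
            (-((algebraMap F (AdeleRing (𝓞 F) F)) h • (1 : Matrix (Fin n) (Fin n) (AdeleRing (𝓞 F) F)))) (-(((algebraMap F (AdeleRing (𝓞 F) F)) d * (algebraMap F (AdeleRing (𝓞 F) F)) β) • (UnitaryDualPair.adelicGram F e TV TW)⁻¹))) := by
    rw [ratMatrix, Matrix.reindex_apply, Matrix.reindex_apply, ← Matrix.submatrix_map, Matrix.fromBlocks_map]
    congr 1
    have hsm : ∀ (a : F) (M : Matrix (Fin n) (Fin n) F), (a • M).map (algebraMap F (AdeleRing (𝓞 F) F)) = (algebraMap F (AdeleRing (𝓞 F) F)) a • M.map (algebraMap F (AdeleRing (𝓞 F) F)) := fun a M => by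
      ext i j
      simp only [Matrix.map_apply, Matrix.smul_apply, smul_eq_mul, map_mul]
    rw [Matrix.map_neg _ (map_neg _), Matrix.map_neg _ (map_neg _), hsm, hsm, hsm, map_mul,
      Matrix.map_one _ (map_zero _) (map_one _),
      map_nonsing_inv' (algebraMap F (AdeleRing (𝓞 F) F)) (UnitaryDualPair.isUnit_det_gram F e hVd hWd), ← UnitaryDualPair.adelicGram_eq_map]
  rw [hS, doubledGramFin_eq, Matrix.inv_reindex, Matrix.reindex_apply, Matrix.reindex_apply, Matrix.reindex_apply,
    Matrix.submatrix_mul_equiv]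

set_option maxHeartbeats 400000 in
include hVd hWd in
/-- **BIG-CELL CLAUSES FOR THE COSET OF `γ`** (`γ ∈ U(T_W)(F)`, any rational symplectic `x` over `ι_{eD}(1 ⊗ (γ ⊕ 1)) = ι_e(1 ⊗ γ) ⊕ 1`,
Cayley data `2β(1 − p) = q`, `2dqβ + p + 1 = 0`, `2h = 1`): the two clauses of the Siegel-parabolic criterion
`Weil1964.ratSp_mul_low_inv_mul_symJ_inv_mem_siegelParabolicPi_iff` hold for `δ x⁻¹ δ⁻¹` with slope `𝕋⁻¹ σ_γ`.
[cite: GelbartPiatetskishapiroRallis1987, Part A §2 pp. 7–9] -/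
theorem bigCell_conditions_of_ratSp_eq (γ : rational F E c 1 (TW.map (algebraMap F E)))
    (x₁ : Matrix.symplecticGroup (Fin n) F)
    (hx₁ : UnitaryDualPair.toSp F E c N 1 e (TV.map (algebraMap F E)) (TW.map (algebraMap F E)) hcδ hδ hd hV hW rfl rfl
        (adelicInr F E c N 1 (TV.map (algebraMap F E)) (TW.map (algebraMap F E)) (toAdelic F E c 1 (TW.map (algebraMap F E)) γ)) =
      ratSp F (UnitaryDualPair.adelicGram F e TV TW) (UnitaryDualPair.isUnit_det_adelicGram F e hVd hWd) x₁)
    (x : Matrix.symplecticGroup (Fin (n + n)) F)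
    (hx : ((ratSp F (doubledGramFin F (UnitaryDualPair.adelicGram F e TV TW)) (isUnit_det_doubledGramFin F (UnitaryDualPair.adelicGram F e TV TW) (UnitaryDualPair.isUnit_det_adelicGram F e hVd hWd)) x : symplecticGroup (polar (Weil1964.adelicForm F (Fin (n + n)) (doubledGramFin F (UnitaryDualPair.adelicGram F e TV TW))))) : ((Fin (n + n) → (AdeleRing (𝓞 F) F)) × (Fin (n + n) → (AdeleRing (𝓞 F) F))) ≃ₗ[(AdeleRing (𝓞 F) F)] ((Fin (n + n) → (AdeleRing (𝓞 F) F)) × (Fin (n + n) → (AdeleRing (𝓞 F) F)))) =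
      ((spReindex finSumFinEquiv (Matrix.fromBlocks (UnitaryDualPair.adelicGram F e TV TW) 0 0 (-(UnitaryDualPair.adelicGram F e TV TW)))
        (spSum (UnitaryDualPair.adelicGram F e TV TW) (-(UnitaryDualPair.adelicGram F e TV TW)) (ratSp F (UnitaryDualPair.adelicGram F e TV TW) (UnitaryDualPair.isUnit_det_adelicGram F e hVd hWd) x₁, (1 : symplecticGroup (polar (Matrix.toLinearMap₂' (AdeleRing (𝓞 F) F) (-(UnitaryDualPair.adelicGram F e TV TW))))))) : symplecticGroup (polar (Matrix.toLinearMap₂' (AdeleRing (𝓞 F) F) (Matrix.reindex finSumFinEquiv finSumFinEquiv (Matrix.fromBlocks (UnitaryDualPair.adelicGram F e TV TW) 0 0 (-(UnitaryDualPair.adelicGram F e TV TW))))))) : ((Fin (n + n) → (AdeleRing (𝓞 F) F)) × (Fin (n + n) → (AdeleRing (𝓞 F) F))) ≃ₗ[(AdeleRing (𝓞 F) F)] ((Fin (n + n) → (AdeleRing (𝓞 F) F)) × (Fin (n + n) → (AdeleRing (𝓞 F) F)))))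
    (β h : F) (h1 : 2 * β * (1 - QuadraticCoordinates.re (quadraticRatCoords E (not_mem_range_algebraMap_of_apply_eq_neg E c hcδ hδ)).toAddEquiv
          (((γ : GL (Fin 1) E) : Matrix (Fin 1) (Fin 1) E) 0 0)) = QuadraticCoordinates.im (quadraticRatCoords E (not_mem_range_algebraMap_of_apply_eq_neg E c hcδ hδ)).toAddEquiv
          (((γ : GL (Fin 1) E) : Matrix (Fin 1) (Fin 1) E) 0 0))
    (h2 : 2 * d * QuadraticCoordinates.im (quadraticRatCoords E (not_mem_range_algebraMap_of_apply_eq_neg E c hcδ hδ)).toAddEquiv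
          (((γ : GL (Fin 1) E) : Matrix (Fin 1) (Fin 1) E) 0 0) * β + QuadraticCoordinates.re (quadraticRatCoords E (not_mem_range_algebraMap_of_apply_eq_neg E c hcδ hδ)).toAddEquiv
          (((γ : GL (Fin 1) E) : Matrix (Fin 1) (Fin 1) E) 0 0) + 1 = 0) (hh : 2 * h = 1) :
    (∀ y : Fin (n + n) → (AdeleRing (𝓞 F) F),
        (((ratSp F (doubledGramFin F (UnitaryDualPair.adelicGram F e TV TW)) (isUnit_det_doubledGramFin F (UnitaryDualPair.adelicGram F e TV TW) (UnitaryDualPair.isUnit_det_adelicGram F e hVd hWd)) (doublingDeltaRat F * x⁻¹ * (doublingDeltaRat F)⁻¹) : symplecticGroup (polar (Weil1964.adelicForm F (Fin (n + n)) (doubledGramFin F (UnitaryDualPair.adelicGram F e TV TW))))) :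
          ((Fin (n + n) → (AdeleRing (𝓞 F) F)) × (Fin (n + n) → (AdeleRing (𝓞 F) F))) ≃ₗ[(AdeleRing (𝓞 F) F)] ((Fin (n + n) → (AdeleRing (𝓞 F) F)) × (Fin (n + n) → (AdeleRing (𝓞 F) F))))
          ((doubledGramFin F (UnitaryDualPair.adelicGram F e TV TW)) *ᵥ y, -(((doubledGramFin F (UnitaryDualPair.adelicGram F e TV TW))⁻¹ * ratMatrix F
            (Matrix.reindex finSumFinEquiv finSumFinEquiv
          (Matrix.fromBlocks (β • (UnitaryDualPair.gram F e TV TW)) (-(h • (1 : Matrix (Fin n) (Fin n) F))) (-(h • (1 : Matrix (Fin n) (Fin n) F)))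
            (-((d * β) • (UnitaryDualPair.gram F e TV TW)⁻¹))))) *ᵥ ((doubledGramFin F (UnitaryDualPair.adelicGram F e TV TW)) *ᵥ y)))).1 = 0) ∧
      ∀ y : Fin (n + n) → (AdeleRing (𝓞 F) F),
        (((ratSp F (doubledGramFin F (UnitaryDualPair.adelicGram F e TV TW)) (isUnit_det_doubledGramFin F (UnitaryDualPair.adelicGram F e TV TW) (UnitaryDualPair.isUnit_det_adelicGram F e hVd hWd)) (doublingDeltaRat F * x⁻¹ * (doublingDeltaRat F)⁻¹) : symplecticGroup (polar (Weil1964.adelicForm F (Fin (n + n)) (doubledGramFin F (UnitaryDualPair.adelicGram F e TV TW))))) :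
          ((Fin (n + n) → (AdeleRing (𝓞 F) F)) × (Fin (n + n) → (AdeleRing (𝓞 F) F))) ≃ₗ[(AdeleRing (𝓞 F) F)] ((Fin (n + n) → (AdeleRing (𝓞 F) F)) × (Fin (n + n) → (AdeleRing (𝓞 F) F)))).symm (0, y)).2 =
          -(((doubledGramFin F (UnitaryDualPair.adelicGram F e TV TW))⁻¹ * ratMatrix F
            (Matrix.reindex finSumFinEquiv finSumFinEquiv
          (Matrix.fromBlocks (β • (UnitaryDualPair.gram F e TV TW)) (-(h • (1 : Matrix (Fin n) (Fin n) F))) (-(h • (1 : Matrix (Fin n) (Fin n) F)))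
            (-((d * β) • (UnitaryDualPair.gram F e TV TW)⁻¹))))) *ᵥ
            (((ratSp F (doubledGramFin F (UnitaryDualPair.adelicGram F e TV TW)) (isUnit_det_doubledGramFin F (UnitaryDualPair.adelicGram F e TV TW) (UnitaryDualPair.isUnit_det_adelicGram F e hVd hWd)) (doublingDeltaRat F * x⁻¹ * (doublingDeltaRat F)⁻¹) : symplecticGroup (polar (Weil1964.adelicForm F (Fin (n + n)) (doubledGramFin F (UnitaryDualPair.adelicGram F e TV TW))))) :
          ((Fin (n + n) → (AdeleRing (𝓞 F) F)) × (Fin (n + n) → (AdeleRing (𝓞 F) F))) ≃ₗ[(AdeleRing (𝓞 F) F)] ((Fin (n + n) → (AdeleRing (𝓞 F) F)) × (Fin (n + n) → (AdeleRing (𝓞 F) F)))).symm (0, y)).1) := by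
  have hg : ∀ u v : Fin n → (AdeleRing (𝓞 F) F), ((ratSp F (UnitaryDualPair.adelicGram F e TV TW) (UnitaryDualPair.isUnit_det_adelicGram F e hVd hWd) x₁ : symplecticGroup (polar (Weil1964.adelicForm F (Fin n) (UnitaryDualPair.adelicGram F e TV TW)))) :
      ((Fin n → (AdeleRing (𝓞 F) F)) × (Fin n → (AdeleRing (𝓞 F) F))) ≃ₗ[(AdeleRing (𝓞 F) F)] ((Fin n → (AdeleRing (𝓞 F) F)) × (Fin n → (AdeleRing (𝓞 F) F)))) (u, v) =
      ((algebraMap F (AdeleRing (𝓞 F) F)) (QuadraticCoordinates.re (quadraticRatCoords E (not_mem_range_algebraMap_of_apply_eq_neg E c hcδ hδ)).toAddEquiv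
          (((γ : GL (Fin 1) E) : Matrix (Fin 1) (Fin 1) E) 0 0)) • u + ((algebraMap F (AdeleRing (𝓞 F) F)) d * (algebraMap F (AdeleRing (𝓞 F) F)) (QuadraticCoordinates.im (quadraticRatCoords E (not_mem_range_algebraMap_of_apply_eq_neg E c hcδ hδ)).toAddEquiv
          (((γ : GL (Fin 1) E) : Matrix (Fin 1) (Fin 1) E) 0 0))) • v,
        (algebraMap F (AdeleRing (𝓞 F) F)) (QuadraticCoordinates.im (quadraticRatCoords E (not_mem_range_algebraMap_of_apply_eq_neg E c hcδ hδ)).toAddEquiv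
          (((γ : GL (Fin 1) E) : Matrix (Fin 1) (Fin 1) E) 0 0)) • u + (algebraMap F (AdeleRing (𝓞 F) F)) (QuadraticCoordinates.re (quadraticRatCoords E (not_mem_range_algebraMap_of_apply_eq_neg E c hcδ hδ)).toAddEquiv
          (((γ : GL (Fin 1) E) : Matrix (Fin 1) (Fin 1) E) 0 0)) • v) := fun u v => by
    rw [← hx₁, toSp_adelicInr_toAdelic_apply, map_mul]
  have h1' : 2 * (algebraMap F (AdeleRing (𝓞 F) F)) β * (1 - (algebraMap F (AdeleRing (𝓞 F) F)) (QuadraticCoordinates.re (quadraticRatCoords E (not_mem_range_algebraMap_of_apply_eq_neg E c hcδ hδ)).toAddEquiv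
          (((γ : GL (Fin 1) E) : Matrix (Fin 1) (Fin 1) E) 0 0))) = (algebraMap F (AdeleRing (𝓞 F) F)) (QuadraticCoordinates.im (quadraticRatCoords E (not_mem_range_algebraMap_of_apply_eq_neg E c hcδ hδ)).toAddEquiv
          (((γ : GL (Fin 1) E) : Matrix (Fin 1) (Fin 1) E) 0 0)) := by
    have := congrArg (algebraMap F (AdeleRing (𝓞 F) F)) h1
    simpa only [map_mul, map_sub, map_one, map_ofNat] using this
  have h2' : 2 * (algebraMap F (AdeleRing (𝓞 F) F)) d * (algebraMap F (AdeleRing (𝓞 F) F)) (QuadraticCoordinates.im (quadraticRatCoords E (not_mem_range_algebraMap_of_apply_eq_neg E c hcδ hδ)).toAddEquiv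
          (((γ : GL (Fin 1) E) : Matrix (Fin 1) (Fin 1) E) 0 0)) * (algebraMap F (AdeleRing (𝓞 F) F)) β + (algebraMap F (AdeleRing (𝓞 F) F)) (QuadraticCoordinates.re (quadraticRatCoords E (not_mem_range_algebraMap_of_apply_eq_neg E c hcδ hδ)).toAddEquiv
          (((γ : GL (Fin 1) E) : Matrix (Fin 1) (Fin 1) E) 0 0)) + 1 = 0 := by
    have := congrArg (algebraMap F (AdeleRing (𝓞 F) F)) h2
    simpa only [map_mul, map_add, map_one, map_zero, map_ofNat] using this
  have hh' : 2 * (algebraMap F (AdeleRing (𝓞 F) F)) h = 1 := by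
    have := congrArg (algebraMap F (AdeleRing (𝓞 F) F)) hh
    simpa only [map_mul, map_one, map_ofNat] using this
  have hS := Weil1964.doublingDelta_conj_spSum_one_inv_bigCell_conditions (UnitaryDualPair.adelicGram F e TV TW) (UnitaryDualPair.isUnit_det_adelicGram F e hVd hWd) ((algebraMap F (AdeleRing (𝓞 F) F)) (QuadraticCoordinates.re (quadraticRatCoords E (not_mem_range_algebraMap_of_apply_eq_neg E c hcδ hδ)).toAddEquiv
          (((γ : GL (Fin 1) E) : Matrix (Fin 1) (Fin 1) E) 0 0))) ((algebraMap F (AdeleRing (𝓞 F) F)) (QuadraticCoordinates.im (quadraticRatCoords E (not_mem_range_algebraMap_of_apply_eq_neg E c hcδ hδ)).toAddEquiv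
          (((γ : GL (Fin 1) E) : Matrix (Fin 1) (Fin 1) E) 0 0)))
    ((algebraMap F (AdeleRing (𝓞 F) F)) d) ((algebraMap F (AdeleRing (𝓞 F) F)) β) ((algebraMap F (AdeleRing (𝓞 F) F)) h) (ratSp F (UnitaryDualPair.adelicGram F e TV TW) (UnitaryDualPair.isUnit_det_adelicGram F e hVd hWd) x₁) h1' h2' hh' hg
  have hR := bigCell_conditions_spReindex finSumFinEquiv (Matrix.fromBlocks (UnitaryDualPair.adelicGram F e TV TW) 0 0 (-(UnitaryDualPair.adelicGram F e TV TW))) _ _ hS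
  have hδ' : ((ratSp F (doubledGramFin F (UnitaryDualPair.adelicGram F e TV TW)) (isUnit_det_doubledGramFin F (UnitaryDualPair.adelicGram F e TV TW) (UnitaryDualPair.isUnit_det_adelicGram F e hVd hWd)) (doublingDeltaRat F) : symplecticGroup (polar (Weil1964.adelicForm F (Fin (n + n)) (doubledGramFin F (UnitaryDualPair.adelicGram F e TV TW))))) : ((Fin (n + n) → (AdeleRing (𝓞 F) F)) × (Fin (n + n) → (AdeleRing (𝓞 F) F))) ≃ₗ[(AdeleRing (𝓞 F) F)] ((Fin (n + n) → (AdeleRing (𝓞 F) F)) × (Fin (n + n) → (AdeleRing (𝓞 F) F)))) =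
      ((spReindex finSumFinEquiv (Matrix.fromBlocks (UnitaryDualPair.adelicGram F e TV TW) 0 0 (-(UnitaryDualPair.adelicGram F e TV TW))) (doublingDelta (UnitaryDualPair.adelicGram F e TV TW) (UnitaryDualPair.isUnit_det_adelicGram F e hVd hWd)) : symplecticGroup (polar (Matrix.toLinearMap₂' (AdeleRing (𝓞 F) F) (Matrix.reindex finSumFinEquiv finSumFinEquiv (Matrix.fromBlocks (UnitaryDualPair.adelicGram F e TV TW) 0 0 (-(UnitaryDualPair.adelicGram F e TV TW))))))) :
        ((Fin (n + n) → (AdeleRing (𝓞 F) F)) × (Fin (n + n) → (AdeleRing (𝓞 F) F))) ≃ₗ[(AdeleRing (𝓞 F) F)] ((Fin (n + n) → (AdeleRing (𝓞 F) F)) × (Fin (n + n) → (AdeleRing (𝓞 F) F)))) :=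
    congrArg Subtype.val (ratSp_doublingDeltaRat F (UnitaryDualPair.adelicGram F e TV TW) (UnitaryDualPair.isUnit_det_adelicGram F e hVd hWd))
  have hG : ((ratSp F (doubledGramFin F (UnitaryDualPair.adelicGram F e TV TW)) (isUnit_det_doubledGramFin F (UnitaryDualPair.adelicGram F e TV TW) (UnitaryDualPair.isUnit_det_adelicGram F e hVd hWd)) (doublingDeltaRat F * x⁻¹ * (doublingDeltaRat F)⁻¹) : symplecticGroup (polar (Weil1964.adelicForm F (Fin (n + n)) (doubledGramFin F (UnitaryDualPair.adelicGram F e TV TW))))) :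
          ((Fin (n + n) → (AdeleRing (𝓞 F) F)) × (Fin (n + n) → (AdeleRing (𝓞 F) F))) ≃ₗ[(AdeleRing (𝓞 F) F)] ((Fin (n + n) → (AdeleRing (𝓞 F) F)) × (Fin (n + n) → (AdeleRing (𝓞 F) F)))) =
      ((spReindex finSumFinEquiv (Matrix.fromBlocks (UnitaryDualPair.adelicGram F e TV TW) 0 0 (-(UnitaryDualPair.adelicGram F e TV TW)))
          (doublingDelta (UnitaryDualPair.adelicGram F e TV TW) (UnitaryDualPair.isUnit_det_adelicGram F e hVd hWd) * (spSum (UnitaryDualPair.adelicGram F e TV TW) (-(UnitaryDualPair.adelicGram F e TV TW)) (ratSp F (UnitaryDualPair.adelicGram F e TV TW) (UnitaryDualPair.isUnit_det_adelicGram F e hVd hWd) x₁,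
            (1 : symplecticGroup (polar (Matrix.toLinearMap₂' (AdeleRing (𝓞 F) F) (-(UnitaryDualPair.adelicGram F e TV TW)))))))⁻¹ *
            (doublingDelta (UnitaryDualPair.adelicGram F e TV TW) (UnitaryDualPair.isUnit_det_adelicGram F e hVd hWd))⁻¹) : symplecticGroup (polar (Matrix.toLinearMap₂' (AdeleRing (𝓞 F) F) (Matrix.reindex finSumFinEquiv finSumFinEquiv (Matrix.fromBlocks (UnitaryDualPair.adelicGram F e TV TW) 0 0 (-(UnitaryDualPair.adelicGram F e TV TW))))))) :
          ((Fin (n + n) → (AdeleRing (𝓞 F) F)) × (Fin (n + n) → (AdeleRing (𝓞 F) F))) ≃ₗ[(AdeleRing (𝓞 F) F)] ((Fin (n + n) → (AdeleRing (𝓞 F) F)) × (Fin (n + n) → (AdeleRing (𝓞 F) F)))) := by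
    exact (coe_map_mul_inv_mul_inv _ (ratSp F (doubledGramFin F (UnitaryDualPair.adelicGram F e TV TW)) (isUnit_det_doubledGramFin F (UnitaryDualPair.adelicGram F e TV TW) (UnitaryDualPair.isUnit_det_adelicGram F e hVd hWd))) _ _).trans
      ((congrArg₂ (fun a b => a * b⁻¹ * a⁻¹) hδ' hx).trans (coe_map_mul_inv_mul_inv _ (spReindex finSumFinEquiv _) _ _).symm)
  rw [hG, doubledGramFin_inv_mul_ratMatrix_sigma0 F N e hVd hWd β h]
  exact ⟨fun y => hR.1 _, hR.2⟩

include hVd hWd in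
/-- **THE COSET OF `γ` LIES IN THE BIG CELL `P_𝕐 · J · n⁻(σ_γ)`**: `ratSp (δ x⁻¹ δ⁻¹ · n⁻(σ_γ)⁻¹ · J⁻¹) ∈ P_𝕐(𝔸)` for any rational
symplectic `x` over `ι(1 ⊗ (γ ⊕ 1))` and Cayley data `(β, h)`. [cite: GelbartPiatetskishapiroRallis1987, Part A §2 pp. 7–9] [cite: Kudla1994, §1] -/
theorem ratSp_conj_inv_mem_bigCell_of_ratSp_eq (γ : rational F E c 1 (TW.map (algebraMap F E)))
    (x₁ : Matrix.symplecticGroup (Fin n) F)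
    (hx₁ : UnitaryDualPair.toSp F E c N 1 e (TV.map (algebraMap F E)) (TW.map (algebraMap F E)) hcδ hδ hd hV hW rfl rfl
        (adelicInr F E c N 1 (TV.map (algebraMap F E)) (TW.map (algebraMap F E)) (toAdelic F E c 1 (TW.map (algebraMap F E)) γ)) =
      ratSp F (UnitaryDualPair.adelicGram F e TV TW) (UnitaryDualPair.isUnit_det_adelicGram F e hVd hWd) x₁)
    (x : Matrix.symplecticGroup (Fin (n + n)) F)
    (hx : ((ratSp F (doubledGramFin F (UnitaryDualPair.adelicGram F e TV TW)) (isUnit_det_doubledGramFin F (UnitaryDualPair.adelicGram F e TV TW) (UnitaryDualPair.isUnit_det_adelicGram F e hVd hWd)) x : symplecticGroup (polar (Weil1964.adelicForm F (Fin (n + n)) (doubledGramFin F (UnitaryDualPair.adelicGram F e TV TW))))) : ((Fin (n + n) → (AdeleRing (𝓞 F) F)) × (Fin (n + n) → (AdeleRing (𝓞 F) F))) ≃ₗ[(AdeleRing (𝓞 F) F)] ((Fin (n + n) → (AdeleRing (𝓞 F) F)) × (Fin (n + n) → (AdeleRing (𝓞 F) F)))) =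
      ((spReindex finSumFinEquiv (Matrix.fromBlocks (UnitaryDualPair.adelicGram F e TV TW) 0 0 (-(UnitaryDualPair.adelicGram F e TV TW)))
        (spSum (UnitaryDualPair.adelicGram F e TV TW) (-(UnitaryDualPair.adelicGram F e TV TW)) (ratSp F (UnitaryDualPair.adelicGram F e TV TW) (UnitaryDualPair.isUnit_det_adelicGram F e hVd hWd) x₁, (1 : symplecticGroup (polar (Matrix.toLinearMap₂' (AdeleRing (𝓞 F) F) (-(UnitaryDualPair.adelicGram F e TV TW))))))) : symplecticGroup (polar (Matrix.toLinearMap₂' (AdeleRing (𝓞 F) F) (Matrix.reindex finSumFinEquiv finSumFinEquiv (Matrix.fromBlocks (UnitaryDualPair.adelicGram F e TV TW) 0 0 (-(UnitaryDualPair.adelicGram F e TV TW))))))) : ((Fin (n + n) → (AdeleRing (𝓞 F) F)) × (Fin (n + n) → (AdeleRing (𝓞 F) F))) ≃ₗ[(AdeleRing (𝓞 F) F)] ((Fin (n + n) → (AdeleRing (𝓞 F) F)) × (Fin (n + n) → (AdeleRing (𝓞 F) F)))))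
    (β h : F) (h1 : 2 * β * (1 - QuadraticCoordinates.re (quadraticRatCoords E (not_mem_range_algebraMap_of_apply_eq_neg E c hcδ hδ)).toAddEquiv
          (((γ : GL (Fin 1) E) : Matrix (Fin 1) (Fin 1) E) 0 0)) = QuadraticCoordinates.im (quadraticRatCoords E (not_mem_range_algebraMap_of_apply_eq_neg E c hcδ hδ)).toAddEquiv
          (((γ : GL (Fin 1) E) : Matrix (Fin 1) (Fin 1) E) 0 0))
    (h2 : 2 * d * QuadraticCoordinates.im (quadraticRatCoords E (not_mem_range_algebraMap_of_apply_eq_neg E c hcδ hδ)).toAddEquiv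
          (((γ : GL (Fin 1) E) : Matrix (Fin 1) (Fin 1) E) 0 0) * β + QuadraticCoordinates.re (quadraticRatCoords E (not_mem_range_algebraMap_of_apply_eq_neg E c hcδ hδ)).toAddEquiv
          (((γ : GL (Fin 1) E) : Matrix (Fin 1) (Fin 1) E) 0 0) + 1 = 0) (hh : 2 * h = 1) :
    ratSp F (doubledGramFin F (UnitaryDualPair.adelicGram F e TV TW)) (isUnit_det_doubledGramFin F (UnitaryDualPair.adelicGram F e TV TW) (UnitaryDualPair.isUnit_det_adelicGram F e hVd hWd))
        (doublingDeltaRat F * x⁻¹ * (doublingDeltaRat F)⁻¹ *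
          (low (Matrix.reindex finSumFinEquiv finSumFinEquiv
          (Matrix.fromBlocks (β • (UnitaryDualPair.gram F e TV TW)) (-(h • (1 : Matrix (Fin n) (Fin n) F))) (-(h • (1 : Matrix (Fin n) (Fin n) F)))
            (-((d * β) • (UnitaryDualPair.gram F e TV TW)⁻¹)))) (isSymm_sigma0 F N e hV hW β h))⁻¹ * (SymplecticGroup.symJ (Fin (n + n)) F)⁻¹) ∈
      siegelParabolicPi (doubledGramFin F (UnitaryDualPair.adelicGram F e TV TW)) :=
  (Weil1964.ratSp_mul_low_inv_mul_symJ_inv_mem_siegelParabolicPi_iff F (doubledGramFin F (UnitaryDualPair.adelicGram F e TV TW)) (isUnit_det_doubledGramFin F (UnitaryDualPair.adelicGram F e TV TW) (UnitaryDualPair.isUnit_det_adelicGram F e hVd hWd)) _ _ _).2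
    (bigCell_conditions_of_ratSp_eq F E c hcδ hδ hd N e hV hW hVd hWd γ x₁ hx₁ x hx β h h1 h2 hh)

/-- **THE `γ`-TH TERM OF THE UNFOLDED SIEGEL EISENSTEIN SERIES IS A SIEGEL–WEIL ORBITAL INTEGRAL**: for the coset of `x`
(over `ι(1 ⊗ (γ ⊕ 1))`, Cayley data `(β, h)`), `(ω□(r_F δ)(ω□(r_F x⁻¹) Ψ))(0) = ∫ ψ_F(−½ ᵗv σ_γ v) (ω□(r_F δ)Ψ)(v) dν(v)` for the
self-dual Haar measure `ν`. [cite: GelbartPiatetskishapiroRallis1987, Part A §2 pp. 7–9] [cite: Weil1965, n° 39 (30) p. 55] -/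
theorem omega_doublingDeltaLift_omega_ratThetaLiftCont_inv_apply_zero_of_ratSp_eq
    [MeasurableSpace (AdeleRing (𝓞 F) F)] [BorelSpace (AdeleRing (𝓞 F) F)] (ν : MeasureTheory.Measure (Fin (n + n) → (AdeleRing (𝓞 F) F))) [ν.IsAddHaarMeasure]
    (hν : ν (piFundamentalDomain F (Fin (n + n))) = 1) (γ : rational F E c 1 (TW.map (algebraMap F E)))
    (x₁ : Matrix.symplecticGroup (Fin n) F)
    (hx₁ : UnitaryDualPair.toSp F E c N 1 e (TV.map (algebraMap F E)) (TW.map (algebraMap F E)) hcδ hδ hd hV hW rfl rfl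
        (adelicInr F E c N 1 (TV.map (algebraMap F E)) (TW.map (algebraMap F E)) (toAdelic F E c 1 (TW.map (algebraMap F E)) γ)) =
      ratSp F (UnitaryDualPair.adelicGram F e TV TW) (UnitaryDualPair.isUnit_det_adelicGram F e hVd hWd) x₁)
    (x : Matrix.symplecticGroup (Fin (n + n)) F)
    (hx : ((ratSp F (doubledGramFin F (UnitaryDualPair.adelicGram F e TV TW)) (isUnit_det_doubledGramFin F (UnitaryDualPair.adelicGram F e TV TW) (UnitaryDualPair.isUnit_det_adelicGram F e hVd hWd)) x : symplecticGroup (polar (Weil1964.adelicForm F (Fin (n + n)) (doubledGramFin F (UnitaryDualPair.adelicGram F e TV TW))))) : ((Fin (n + n) → (AdeleRing (𝓞 F) F)) × (Fin (n + n) → (AdeleRing (𝓞 F) F))) ≃ₗ[(AdeleRing (𝓞 F) F)] ((Fin (n + n) → (AdeleRing (𝓞 F) F)) × (Fin (n + n) → (AdeleRing (𝓞 F) F)))) =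
      ((spReindex finSumFinEquiv (Matrix.fromBlocks (UnitaryDualPair.adelicGram F e TV TW) 0 0 (-(UnitaryDualPair.adelicGram F e TV TW)))
        (spSum (UnitaryDualPair.adelicGram F e TV TW) (-(UnitaryDualPair.adelicGram F e TV TW)) (ratSp F (UnitaryDualPair.adelicGram F e TV TW) (UnitaryDualPair.isUnit_det_adelicGram F e hVd hWd) x₁, (1 : symplecticGroup (polar (Matrix.toLinearMap₂' (AdeleRing (𝓞 F) F) (-(UnitaryDualPair.adelicGram F e TV TW))))))) : symplecticGroup (polar (Matrix.toLinearMap₂' (AdeleRing (𝓞 F) F) (Matrix.reindex finSumFinEquiv finSumFinEquiv (Matrix.fromBlocks (UnitaryDualPair.adelicGram F e TV TW) 0 0 (-(UnitaryDualPair.adelicGram F e TV TW))))))) : ((Fin (n + n) → (AdeleRing (𝓞 F) F)) × (Fin (n + n) → (AdeleRing (𝓞 F) F))) ≃ₗ[(AdeleRing (𝓞 F) F)] ((Fin (n + n) → (AdeleRing (𝓞 F) F)) × (Fin (n + n) → (AdeleRing (𝓞 F) F)))))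
    (β h : F) (h1 : 2 * β * (1 - QuadraticCoordinates.re (quadraticRatCoords E (not_mem_range_algebraMap_of_apply_eq_neg E c hcδ hδ)).toAddEquiv
          (((γ : GL (Fin 1) E) : Matrix (Fin 1) (Fin 1) E) 0 0)) = QuadraticCoordinates.im (quadraticRatCoords E (not_mem_range_algebraMap_of_apply_eq_neg E c hcδ hδ)).toAddEquiv
          (((γ : GL (Fin 1) E) : Matrix (Fin 1) (Fin 1) E) 0 0))
    (h2 : 2 * d * QuadraticCoordinates.im (quadraticRatCoords E (not_mem_range_algebraMap_of_apply_eq_neg E c hcδ hδ)).toAddEquiv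
          (((γ : GL (Fin 1) E) : Matrix (Fin 1) (Fin 1) E) 0 0) * β + QuadraticCoordinates.re (quadraticRatCoords E (not_mem_range_algebraMap_of_apply_eq_neg E c hcδ hδ)).toAddEquiv
          (((γ : GL (Fin 1) E) : Matrix (Fin 1) (Fin 1) E) 0 0) + 1 = 0) (hh : 2 * h = 1) (Ψ : piSchwartzBruhat F (Fin (n + n))) :
    ((adelicMpCont.omega F (Fin (n + n)) (doubledGramFin F (UnitaryDualPair.adelicGram F e TV TW)) (doublingDeltaLift F (UnitaryDualPair.adelicGram F e TV TW) (UnitaryDualPair.isUnit_det_adelicGram F e hVd hWd))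
          (adelicMpCont.omega F (Fin (n + n)) (doubledGramFin F (UnitaryDualPair.adelicGram F e TV TW))
            (ratThetaLiftCont F (doubledGramFin F (UnitaryDualPair.adelicGram F e TV TW)) (isUnit_det_doubledGramFin F (UnitaryDualPair.adelicGram F e TV TW) (UnitaryDualPair.isUnit_det_adelicGram F e hVd hWd)) x⁻¹) Ψ) :
          piSchwartzBruhat F (Fin (n + n))) : (Fin (n + n) → (AdeleRing (𝓞 F) F)) → ℂ) 0 =
      ∫ v, chirp F ((-⅟(2 : (AdeleRing (𝓞 F) F))) • ratMatrix F (Matrix.reindex finSumFinEquiv finSumFinEquiv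
          (Matrix.fromBlocks (β • (UnitaryDualPair.gram F e TV TW)) (-(h • (1 : Matrix (Fin n) (Fin n) F))) (-(h • (1 : Matrix (Fin n) (Fin n) F)))
            (-((d * β) • (UnitaryDualPair.gram F e TV TW)⁻¹)))))
        ((adelicMpCont.omega F (Fin (n + n)) (doubledGramFin F (UnitaryDualPair.adelicGram F e TV TW)) (doublingDeltaLift F (UnitaryDualPair.adelicGram F e TV TW) (UnitaryDualPair.isUnit_det_adelicGram F e hVd hWd)) Ψ :
            piSchwartzBruhat F (Fin (n + n))) : (Fin (n + n) → (AdeleRing (𝓞 F) F)) → ℂ) v ∂ν :=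
  Weil1964.omega_doublingDeltaLift_omega_ratThetaLiftCont_apply_zero_of_mem_bigCell F (UnitaryDualPair.adelicGram F e TV TW) (UnitaryDualPair.isUnit_det_adelicGram F e hVd hWd) ν hν x⁻¹ _
    (isSymm_sigma0 F N e hV hW β h)
    (ratSp_conj_inv_mem_bigCell_of_ratSp_eq F E c hcδ hδ hd N e hV hW hVd hWd γ x₁ hx₁ x hx β h h1 h2 hh) Ψ

/-- **HEADLINE — THE MAIN ORBIT, UNCONDITIONALLY IN `γ ≠ 1`**: with the Cayley parameter `β(γ) = q / (2(1 − p))` of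
`γ = p + q√d ∈ U(T_W)(F) = E¹`, `γ ≠ 1`, and `h = ½`, the `γ`-th term of the Siegel Eisenstein series unfolded over
`P_W(F) \ U(W□)(F) ≅ E¹` is the orbital integral at the symmetric matrix `σ_γ = reindex [[β 𝕋_F, −½], [−½, −dβ 𝕋_F⁻¹]]` — affine in
`β`, i.e. `F*_Φ(β)` with `Φ = (ω□(r_F δ)Ψ) · ψ_F(½ v₁·v₂)` in the notation of [Weil1965, n° 46 p. 66].
[cite: GelbartPiatetskishapiroRallis1987, Part A §2 pp. 7–9] [cite: Weil1965, n° 39 (30) p. 55] -/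
theorem omega_doublingDeltaLift_omega_ratThetaLiftCont_inv_apply_zero_of_ne_one
    [MeasurableSpace (AdeleRing (𝓞 F) F)] [BorelSpace (AdeleRing (𝓞 F) F)] (ν : MeasureTheory.Measure (Fin (n + n) → (AdeleRing (𝓞 F) F))) [ν.IsAddHaarMeasure]
    (hν : ν (piFundamentalDomain F (Fin (n + n))) = 1) (γ : rational F E c 1 (TW.map (algebraMap F E)))
    (x₁ : Matrix.symplecticGroup (Fin n) F)
    (hx₁ : UnitaryDualPair.toSp F E c N 1 e (TV.map (algebraMap F E)) (TW.map (algebraMap F E)) hcδ hδ hd hV hW rfl rfl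
        (adelicInr F E c N 1 (TV.map (algebraMap F E)) (TW.map (algebraMap F E)) (toAdelic F E c 1 (TW.map (algebraMap F E)) γ)) =
      ratSp F (UnitaryDualPair.adelicGram F e TV TW) (UnitaryDualPair.isUnit_det_adelicGram F e hVd hWd) x₁)
    (x : Matrix.symplecticGroup (Fin (n + n)) F)
    (hx : ((ratSp F (doubledGramFin F (UnitaryDualPair.adelicGram F e TV TW)) (isUnit_det_doubledGramFin F (UnitaryDualPair.adelicGram F e TV TW) (UnitaryDualPair.isUnit_det_adelicGram F e hVd hWd)) x : symplecticGroup (polar (Weil1964.adelicForm F (Fin (n + n)) (doubledGramFin F (UnitaryDualPair.adelicGram F e TV TW))))) : ((Fin (n + n) → (AdeleRing (𝓞 F) F)) × (Fin (n + n) → (AdeleRing (𝓞 F) F))) ≃ₗ[(AdeleRing (𝓞 F) F)] ((Fin (n + n) → (AdeleRing (𝓞 F) F)) × (Fin (n + n) → (AdeleRing (𝓞 F) F)))) =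
      ((spReindex finSumFinEquiv (Matrix.fromBlocks (UnitaryDualPair.adelicGram F e TV TW) 0 0 (-(UnitaryDualPair.adelicGram F e TV TW)))
        (spSum (UnitaryDualPair.adelicGram F e TV TW) (-(UnitaryDualPair.adelicGram F e TV TW)) (ratSp F (UnitaryDualPair.adelicGram F e TV TW) (UnitaryDualPair.isUnit_det_adelicGram F e hVd hWd) x₁, (1 : symplecticGroup (polar (Matrix.toLinearMap₂' (AdeleRing (𝓞 F) F) (-(UnitaryDualPair.adelicGram F e TV TW))))))) : symplecticGroup (polar (Matrix.toLinearMap₂' (AdeleRing (𝓞 F) F) (Matrix.reindex finSumFinEquiv finSumFinEquiv (Matrix.fromBlocks (UnitaryDualPair.adelicGram F e TV TW) 0 0 (-(UnitaryDualPair.adelicGram F e TV TW))))))) : ((Fin (n + n) → (AdeleRing (𝓞 F) F)) × (Fin (n + n) → (AdeleRing (𝓞 F) F))) ≃ₗ[(AdeleRing (𝓞 F) F)] ((Fin (n + n) → (AdeleRing (𝓞 F) F)) × (Fin (n + n) → (AdeleRing (𝓞 F) F)))))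
    (hγ : γ ≠ 1) (Ψ : piSchwartzBruhat F (Fin (n + n))) :
    ((adelicMpCont.omega F (Fin (n + n)) (doubledGramFin F (UnitaryDualPair.adelicGram F e TV TW)) (doublingDeltaLift F (UnitaryDualPair.adelicGram F e TV TW) (UnitaryDualPair.isUnit_det_adelicGram F e hVd hWd))
          (adelicMpCont.omega F (Fin (n + n)) (doubledGramFin F (UnitaryDualPair.adelicGram F e TV TW))
            (ratThetaLiftCont F (doubledGramFin F (UnitaryDualPair.adelicGram F e TV TW)) (isUnit_det_doubledGramFin F (UnitaryDualPair.adelicGram F e TV TW) (UnitaryDualPair.isUnit_det_adelicGram F e hVd hWd)) x⁻¹) Ψ) :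
          piSchwartzBruhat F (Fin (n + n))) : (Fin (n + n) → (AdeleRing (𝓞 F) F)) → ℂ) 0 =
      ∫ v, chirp F ((-⅟(2 : (AdeleRing (𝓞 F) F))) • ratMatrix F (Matrix.reindex finSumFinEquiv finSumFinEquiv
          (Matrix.fromBlocks ((QuadraticCoordinates.im (quadraticRatCoords E (not_mem_range_algebraMap_of_apply_eq_neg E c hcδ hδ)).toAddEquiv
          (((γ : GL (Fin 1) E) : Matrix (Fin 1) (Fin 1) E) 0 0) /
            (2 * (1 - QuadraticCoordinates.re (quadraticRatCoords E (not_mem_range_algebraMap_of_apply_eq_neg E c hcδ hδ)).toAddEquiv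
          (((γ : GL (Fin 1) E) : Matrix (Fin 1) (Fin 1) E) 0 0)))) • (UnitaryDualPair.gram F e TV TW)) (-((1 / 2 : F) • (1 : Matrix (Fin n) (Fin n) F))) (-((1 / 2 : F) • (1 : Matrix (Fin n) (Fin n) F)))
            (-((d * (QuadraticCoordinates.im (quadraticRatCoords E (not_mem_range_algebraMap_of_apply_eq_neg E c hcδ hδ)).toAddEquiv
          (((γ : GL (Fin 1) E) : Matrix (Fin 1) (Fin 1) E) 0 0) /
            (2 * (1 - QuadraticCoordinates.re (quadraticRatCoords E (not_mem_range_algebraMap_of_apply_eq_neg E c hcδ hδ)).toAddEquiv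
          (((γ : GL (Fin 1) E) : Matrix (Fin 1) (Fin 1) E) 0 0))))) • (UnitaryDualPair.gram F e TV TW)⁻¹)))))
        ((adelicMpCont.omega F (Fin (n + n)) (doubledGramFin F (UnitaryDualPair.adelicGram F e TV TW)) (doublingDeltaLift F (UnitaryDualPair.adelicGram F e TV TW) (UnitaryDualPair.isUnit_det_adelicGram F e hVd hWd)) Ψ :
            piSchwartzBruhat F (Fin (n + n))) : (Fin (n + n) → (AdeleRing (𝓞 F) F)) → ℂ) v ∂ν :=
  omega_doublingDeltaLift_omega_ratThetaLiftCont_inv_apply_zero_of_ratSp_eq F E c hcδ hδ hd N e hV hW hVd hWd ν hν γ x₁ hx₁ x hx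
    _ _ (two_mul_cayley_mul_one_sub_re c hcδ hδ (isQuadraticCoordinates_rat E c hcδ hδ hd) hWd γ hγ)
    (two_mul_mul_im_mul_cayley_add c hcδ hδ (isQuadraticCoordinates_rat E c hcδ hδ hd) hWd γ hγ) (by norm_num) Ψ


end BigCell

end UnitaryGroup

end Literature.NumberTheory.Automorphic

end
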